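import Literature.NumberTheory.GaloisRepresentations.PotentialDiagonalizabilityCriteriaProofs
import Literature.NumberTheory.GaloisRepresentations.CrystallineDeformationRing
import Literature.NumberTheory.GaloisRepresentations.LabelledHodgeTateWeights
import HarnessLib

/-!
# Crystalline extension data compatible with the `p`-adic Hodge datum of the summit

Definition item `defn-PstCrystallineExtensionData` (topic `Literature/NumberTheory/GaloisRepresentations`),
wanted by the crux `PD2Unram` (potential diagonalizability for `GL₂` over unramified `p`-adic fields) and
the support `PDChain` (the potentially-diagonalizable automorphy-lifting theorems, Barnet-Lamb–Gee–
Geraghty–Taylor Thm. 4.2.1, Barnet-Lamb–Gee–Geraghty Thm. A.4.1) of route `Langlands/WachComponentCensus`.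

## The gap this file closes

The tree has two vocabularies for "crystalline" at `v ∣ p`:

* the summit statement `Langlands` carries, at each place `v ∣ p`, a `p`-adic Hodge datum
  `𝔇 : PstWeilDeligneData K p` (`K = F_v`; intended `B_dR(K)` and `WD ∘ D_pst`), and "crystalline" there
  is `𝔇.IsCrystallineFramed ρ` (de Rham, Weil–Deligne representation unramified, `N = 0`; file
  `CrystallineDeformationRing`), labelled Hodge–Tate weights being read off `𝔇.𝔅`
  (`PeriodRingData.labelledHodgeTateWeights`, file `LabelledHodgeTateWeights`);
* potential diagonalizability `IsPotentiallyDiagonalizable 𝔅 ρ` (file `PotentialDiagonalizability`,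
  BLGGT §1.4) is relative to **crystalline extension data** `𝔅 : CrystallineExtensionData p K` — one
  crystalline period-ring datum (intended `B_cris(K')`) for every finite `K'/K` inside `K̄`, with NO
  relation between the members, nor with `𝔇`.

A statement "every `𝔇`-crystalline `ρ` (with regular `𝔇.𝔅`-weights) is potentially diagonalizable"
quantified over ALL `𝔅` is junk-refutable (take the genuine datum at `⊥` and the trivial-action base datum
above `⊥`: refuter note on `stmt-Langlands-14643`), and over SOME `𝔅` junk-witnessable.  This file supplies
the requested bridge: an INTERFACE `PstCrystallineExtensionData 𝔇` bundling a `CrystallineExtensionData`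
with the compatibilities — with `𝔇` at the base field and between the levels — that the genuine objects
(Fontaine's `B_cris(K')`, `B_dR(K)`, `D_pst`) satisfy, stated as predicates; existence is NOT a field but
the separate named fact `PstCrystallineExtensionData.nonempty` (same shape as, and refining, the accepted
`CrystallineDeformationRing.nonempty`).  Over it the route items get one-line signatures over the summit's
own datum, e.g. `∀ … (𝔈 : PstCrystallineExtensionData (RD.pst p v hv)), (RD.pst p v hv).IsCrystallineFramed
(ρ.toLocal v) → … → IsPotentiallyDiagonalizable 𝔈.𝔅 (ρ.toLocal v)`.

## Main definitions

* `PstCrystallineExtensionData 𝔇` — fields: `𝔅 : CrystallineExtensionData p K` (for the `ℚ_p`-algebra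
  structure `𝔇.algebra` on `K`) and the axioms
  - `isCrystallineFn_restrictField`: a `𝔇`-crystalline `ρ : Γ_K → GL_n(ℚ̄_p)` is crystalline relative to
    `𝔅 K'` after restriction to every finite `K' ⊆ K̄` ("`* = cris`" points are "`* = K'-cris`" points,
    BLGGT §1.4, p. 13: `Spec R^□_{K'-cris}` is a union of irreducible components of `Spec R^□_{K''-cris}`
    for `K'' ⊃ K'`; Fontaine: `B_cris` depends only on `ℂ_K`, and `D_cris` grows under restriction);
  - `isCrystallineFramed_of_isCrystallineFn_bot`: conversely a `ρ` crystalline relative to the datum at the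
    base field `⊥ ≃ K` is `𝔇`-crystalline (Fontaine, Exposé VIII §1.3, §2.3.7 with Berger's theorem:
    `B_cris`-admissible ⇔ de Rham with `N = 0` and inertia trivial on `D_pst` ⇔ de Rham with `WD(ρ)`
    unramified, `N = 0`) — with the previous axiom at `K' = ⊥` this is the requested equivalence (i),
    `isCrystallineFn_bot_iff`;
  - `isCrystallineFn_restrictField_of_le`: for finite `K' ≤ K''` inside `K̄`, crystalline relative to `𝔅 K'`
    implies crystalline relative to `𝔅 K''` after restriction (requested (iii));
  - `labelledHodgeTateWeights_bot_eq`: when the datum at the base field has full invariant field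
    (`F₀ = ⊤`, i.e. `B^{Γ_K} = K`; for the genuine `B_cris(K)` this is `K₀ = K`, `K/ℚ_p` unramified — the
    route's setting) its filtration computes on `𝔇`-crystalline `ρ` the same `τ`-labelled Hodge–Tate weights
    as `𝔇.𝔅` (requested (ii); see the design note for why the guard is forced).
* API: `isCrystallineFn_bot_iff` ((i) as requested), `isCrystallineFn_restrictField_of_isLocallyUnramified`
  and `isCrystallineFn_restrictField_one` (unramified, e.g. trivial, representations are crystalline at every
  level — from the datum's own axioms), `isPotentiallyCrystallineFn_of_isCrystallineFramed` (the hypothesis of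
  BLGGT Lemma 1.4.3 over `𝔈.𝔅`), `isCrystallineFn_comp_absGaloisRestrict_of_le` ((iii) with the restriction
  written as a composite), and `isPotentiallyDiagonalizable_of_hasInvariantCompleteFlag`: **for every
  `𝔈`, every `𝔇`-crystalline `ρ` with an invariant complete flag (e.g. ordinary crystalline) is potentially
  diagonalizable relative to `𝔈.𝔅`** (BLGGT Lemma 1.4.3 (1), the tree's proved
  `blggt2014_lemma_1_4_3_1_holds`) — the bridge produces PD statements that are provable in the known cases.
* `CrystallineExtensionData.baseLabel 𝔅 τ` — the label `τ : K →+* E` restricted to the invariant field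
  `F₀ ⊆ ⊥ ≃ K` of the datum at the base (through `IntermediateField.botEquiv`).
* Named fact `PstCrystallineExtensionData.nonempty` (D-0014) and its projection
  `PstCrystallineExtensionData.nonempty.crystallineDeformationRing_nonempty` onto the accepted
  `CrystallineDeformationRing.nonempty`.

## Design notes

* **Parametrised by `𝔇`, compatibilities as predicates, no maps between period rings.**  Exactly as the
  accepted `PstWeilDeligneData` / `PointwiseLiftingRing`: the fields are the properties of the genuine objects
  that the tree can phrase and that consumers use; the `ℚ_p`-algebra structure on `K` is `𝔇.algebra`
  throughout (`letI`), as in `PstWeilDeligneData.IsDeRhamWithWeightsIn`.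
* **Restriction is stated for continuous representations, not bare matrix functions**: `IsCrystallineFn 𝔅 f`
  is vacuous for an `f` without finite models, while `f ∘ res` may have models, so the bare-function form of
  (iii) would be false for the genuine data.  The base-to-`K'` axiom is kept as a field (rather than derived
  from the case `K' = ⊥` and (iii), which differ from it by an inner automorphism of `Γ_K`,
  `absGaloisRestrict_isConj_of_algHom`): it is the form every consumer needs first, and it is true of the
  genuine data.
* **Why (ii) carries the guard `F₀ = ⊤`.**  For Fontaine's `B_cris(K)` the invariant field is `K₀` and the
  filtration is `Fil^i B_cris = B_cris ∩ t^i B_dR^+`; the Hodge filtration of a crystalline `V` lives on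
  `K ⊗_{K₀} D_cris(V) = D_dR(V)` (Brinon–Conrad, CMI notes, Thm. 9.1.5 and p. 132; Prop. 9.1.9), and the
  filtration induced on the `K₀`-form `D_cris(V)` itself is `D_cris ∩ Fil^• D_dR`, which for ramified `K`
  is in general position (e.g. `0` in positive degrees for a generic weakly admissible module with weights
  `{0, 1}`), so it does NOT compute `HT_τ`.  When `K₀ = K` the two filtered spaces coincide
  (`(M ⊗ B_cris) ∩ (M ⊗ Fil^i B_dR) = M ⊗ Fil^i B_cris` for a vector space `M`), label by label.  Hence the
  only honest form of "the same labelled Hodge–Tate weights as `𝔇.𝔅`" that the genuine data satisfy for every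
  `K` is the guarded one; BLGGT themselves define `HT_τ` through `B_dR`/`ℂ_p` (Introduction, Notation), never
  through `B_cris`, and every consumer reads weights off `𝔇.𝔅` — the field is a consistency constraint, live
  exactly in the absolutely unramified case of the requesting route.
* **Labels.**  `τ : K →+* ℚ̄_p` as in `PeriodRingData.labelledHodgeTateWeights`; on the crystalline side the
  label is `CrystallineExtensionData.baseLabel 𝔅 τ : F₀ →+* ℚ̄_p` (restriction through `⊥ ≃ K`); weights are
  computed `ℚ̄_p`-linearly on `ℚ̄_pⁿ ⊗_{ℚ_p} B` (no model), as in `FramedGaloisRep.labelledHodgeTateWeightsAt`.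
* **Universes.**  `K : Type`, period rings in `Type` (`CrystallineExtensionData.{0, 0}`), as
  `PstWeilDeligneData` (`PeriodRingData.{0,0,0,0}`); the structure lives in `Type 1`.
* **No existence inside the structure; non-vacuity.**  An instance for the genuine `𝔇` is Fontaine's
  `(B_cris(K'))_{K'}` — the open definition items "construct `B_cris` / `B_dR` / `D_pst`"; the named fact
  records it.  What is provable now, for EVERY instance: the trivial representation (indeed every unramified
  one) is crystalline at all levels, and ordinary crystalline representations are potentially diagonalizable
  (`isPotentiallyDiagonalizable_of_hasInvariantCompleteFlag`).  A fully constructed toy instance (the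
  "unramified tower" over the accepted `unramifiedPstWeilDeligneData`, crystalline := unramified at every
  level) is deliberately not attempted here.

## Deliberately NOT here

* The `∼`-calculus of BLGGT §1.4 over `ConnectsOver` (restriction to `K'`, transitivity via Kisin 2008
  Thm. (3.3.8)), BLGGT Thm. 4.2.1 / BLGG Thm. A.4.1 themselves (cite items of the route, now statable over
  `PstCrystallineExtensionData`), and Lemma 1.4.3 (2) (Fontaine–Laffaille range).
* Descent of crystallinity along unramified `K'/K` (Brinon–Conrad Prop. 9.3.1) and the comparison
  `K ⊗_{K₀} D_cris ≅ D_dR` as filtered modules (needs maps between the period rings, not predicates).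

## References

* T. Barnet-Lamb, T. Gee, D. Geraghty, R. Taylor, *Potential automorphy and change of weight*, Ann. of
  Math. 179 (2014): Introduction, Notation (`HT_τ` via `ℂ_p`; arXiv:1010.2561 p. 6); §1.4 pp. 13–15
  (`* = cris, K'-cris`; "If `K'' ⊃ K'` then `Spec R^□_{K'-cris}` is a union of irreducible components of
  `Spec R^□_{K''-cris}`"; `∼`; diagonalizable, potentially diagonalizable; Lemma 1.4.1; Lemma 1.4.3);
  Thm. 4.2.1. [BarnetlambEtAl2014]
* J.-M. Fontaine, *Représentations `p`-adiques semi-stables*, Astérisque 223 (1994), Exposé III §5.1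
  (`B_cris`-admissible = crystalline; crystalline ⇒ de Rham). [FontaineAsterisque223III]
* J.-M. Fontaine, *Représentations `ℓ`-adiques potentiellement semi-stables*, Astérisque 223 (1994),
  Exposé VIII §1.3, §2.3.7 (Weil–Deligne representation of a pst representation; crystalline ⇔ `N = 0` and
  inertia trivial). [FontaineAsterisque223VIII]
* L. Berger, *Représentations `p`-adiques et équations différentielles*, Invent. Math. 148 (2002), Thm. 0.7
  (de Rham ⇒ potentially semi-stable). [BergerLaurent2002]
* O. Brinon, B. Conrad, *CMI Summer School notes on `p`-adic Hodge theory* (2009), Thm. 9.1.5, Prop. 9.1.6,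
  Prop. 9.1.9, p. 132 (filtration on `K ⊗_{K₀} D_cris`), §9.3 (Prop. 9.3.1, Thm. 9.3.5). [BrinonConrad2009]
* M. Kisin, *Potentially semi-stable deformation rings*, J. Amer. Math. Soc. 21 (2008), Thm. (2.7.6),
  Cor. (2.7.7), Thm. (3.3.8). [Kisin2007]
-/

noncomputable section

open Field

namespace Literature.NumberTheory.GaloisRepresentations

/-! ### Labels at the base field of crystalline extension data -/

section BaseLabel

universe u v w

variable {p : ℕ} [Fact p.Prime] {K : Type u} [Field K] [Algebra ℚ_[p] K] {E : Type v} [Semiring E]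

/-- The **label at the base field** attached to `τ : K →+* E`: its restriction to the invariant field
`F₀ ⊆ ⊥` of the crystalline datum `𝔅 ⊥` at the bottom field `⊥ ≃ K` of `K̄/K`
(through `IntermediateField.botEquiv K K̄ : ⊥ ≃ₐ[K] K`).  For the genuine `B_cris(K)`, `F₀ = K₀` and this
is `τ|_{K₀}`. [folklore] -/
def CrystallineExtensionData.baseLabel (𝔅 : CrystallineExtensionData.{u, w} p K) (τ : K →+* E) :
    (𝔅 ⊥ inferInstance).F₀ →+* E :=
  τ.comp (((IntermediateField.botEquiv K (AlgebraicClosure K)).toAlgHom.toRingHom).comp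
    (algebraMap ((𝔅 ⊥ inferInstance).F₀) (⊥ : IntermediateField K (AlgebraicClosure K))))

/-- Unfolding lemma for `CrystallineExtensionData.baseLabel`. [folklore] -/
@[simp] lemma CrystallineExtensionData.baseLabel_apply (𝔅 : CrystallineExtensionData.{u, w} p K)
    (τ : K →+* E) (x : (𝔅 ⊥ inferInstance).F₀) :
    𝔅.baseLabel τ x = τ (IntermediateField.botEquiv K (AlgebraicClosure K)
      (algebraMap ((𝔅 ⊥ inferInstance).F₀) (⊥ : IntermediateField K (AlgebraicClosure K)) x)) :=
  rfl

end BaseLabel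

/-! ### The interface -/

section Pst

variable {K : Type} [Field K] [ValuativeRel K] [TopologicalSpace K] [IsNonarchimedeanLocalField K]
  {p : ℕ} [Fact p.Prime]

/-- **Crystalline extension data compatible with the `p`-adic Hodge datum `𝔇` of the base field**
(intended instance: Fontaine's `B_cris(K')` for the finite extensions `K'` of `K` inside `K̄`, together
with the genuine `𝔇 = (B_dR(K), WD ∘ D_pst)`).  Fields: crystalline extension data `𝔅` for `K` (with the
`ℚ_p`-algebra structure `𝔇.algebra`; file `PotentialDiagonalizability`), and the compatibilities, stated as
predicates on `IsCrystallineFn` (every model over a finite `E'/ℚ_p` is `B`-admissible):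
* `isCrystallineFn_restrictField` — a `𝔇`-crystalline `ρ : Γ_K → GL_n(ℚ̄_p)` (`𝔇.IsCrystallineFramed`: de
  Rham, `WD(ρ)` unramified, `N = 0`) is crystalline relative to `𝔅 K'` after restriction to `Γ_{K'}` for
  every finite `K' ⊆ K̄` (crystalline points are `K'`-crystalline points, BLGGT §1.4 p. 13);
* `isCrystallineFramed_of_isCrystallineFn_bot` — a `ρ` crystalline relative to the datum at the base field
  `⊥ ≃ K` is `𝔇`-crystalline (`B_cris`-admissible ⇔ de Rham with `N = 0` and inertia trivial on `D_pst`,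
  Fontaine Exposé VIII §1.3, §2.3.7, with Berger: de Rham ⇒ pst);
* `isCrystallineFn_restrictField_of_le` — for finite `K' ≤ K''` inside `K̄`, crystalline relative to `𝔅 K'`
  implies crystalline relative to `𝔅 K''` after restriction;
* `labelledHodgeTateWeights_bot_eq` — if the datum at the base field has invariant field all of `⊥ ≃ K`
  (`F₀ = ⊤`; for `B_cris(K)`: `K₀ = K`, i.e. `K/ℚ_p` unramified), its filtration computes on
  `𝔇`-crystalline `ρ` the same `τ`-labelled Hodge–Tate weights as `𝔇.𝔅` (`K ⊗_{K₀} D_cris ≅ D_dR` as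
  filtered modules, Brinon–Conrad Prop. 9.1.9; for ramified `K` the filtration of `D_cris` is not the Hodge
  filtration and nothing is asserted).
No existence is built in: that the genuine objects form an instance is the named fact
`PstCrystallineExtensionData.nonempty`. [cite: BarnetlambEtAl2014, §1.4 (pp. 13–14)] [cite: FontaineAsterisque223VIII, §1.3 and §2.3.7] [cite: FontaineAsterisque223III, §5.1] -/
structure PstCrystallineExtensionData (𝔇 : PstWeilDeligneData K p) : Type 1 where
  /-- The crystalline period-ring data along the finite extensions of `K` inside `K̄` (intended:
  `K' ↦ B_cris(K')`), for the `ℚ_p`-algebra structure `𝔇.algebra` on `K`. -/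
  𝔅 : letI := 𝔇.algebra; CrystallineExtensionData.{0, 0} p K
  /-- A `𝔇`-crystalline representation of `Γ_K` is crystalline relative to `𝔅 K'` after restriction to
  `Γ_{K'}`, for every finite `K' ⊆ K̄`. -/
  isCrystallineFn_restrictField : letI := 𝔇.algebra
    ∀ {n : ℕ} (ρ : FramedGaloisRep K (PadicAlgCl p) n) (K' : IntermediateField K (AlgebraicClosure K))
      (hK' : FiniteDimensional K K'),
      𝔇.IsCrystallineFramed ρ → IsCrystallineFn (𝔅 K' hK') (ρ.restrictField K').matrixFn
  /-- A representation of `Γ_K` which is crystalline relative to the datum at the base field `⊥ ≃ K` is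
  `𝔇`-crystalline. -/
  isCrystallineFramed_of_isCrystallineFn_bot : letI := 𝔇.algebra
    ∀ {n : ℕ} (ρ : FramedGaloisRep K (PadicAlgCl p) n),
      IsCrystallineFn (𝔅 ⊥ inferInstance)
          (ρ.restrictField (⊥ : IntermediateField K (AlgebraicClosure K))).matrixFn →
        𝔇.IsCrystallineFramed ρ
  /-- Restriction along finite `K' ≤ K''` inside `K̄` preserves crystallinity. -/
  isCrystallineFn_restrictField_of_le : letI := 𝔇.algebra
    ∀ {n : ℕ} (K' K'' : IntermediateField K (AlgebraicClosure K)) (hle : K' ≤ K'')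
      (hK' : FiniteDimensional K K') (hK'' : FiniteDimensional K K'')
      (ρ : FramedGaloisRep K' (PadicAlgCl p) n),
      IsCrystallineFn (𝔅 K' hK') ρ.matrixFn →
        letI : Algebra K' K'' := (IntermediateField.inclusion hle).toRingHom.toAlgebra
        IsCrystallineFn (𝔅 K'' hK'') (ρ.restrictField K'').matrixFn
  /-- When the datum at the base field has full invariant field (`F₀ = ⊤`), its filtration computes the
  `τ`-labelled Hodge–Tate weights of `𝔇`-crystalline representations, as `𝔇.𝔅` does. -/
  labelledHodgeTateWeights_bot_eq : letI := 𝔇.algebra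
    ∀ {n : ℕ} (ρ : FramedGaloisRep K (PadicAlgCl p) n) (τ : K →+* PadicAlgCl p),
      𝔇.IsCrystallineFramed ρ → (𝔅 ⊥ inferInstance).F₀ = ⊤ →
        (𝔅 ⊥ inferInstance).toPeriodRingData.labelledHodgeTateWeights
            (ρ.restrictField (⊥ : IntermediateField K (AlgebraicClosure K))).toGaloisRep
            (CrystallineExtensionData.baseLabel 𝔅 τ) =
          𝔇.𝔅.labelledHodgeTateWeights ρ.toGaloisRep τ

namespace PstCrystallineExtensionData

variable {𝔇 : PstWeilDeligneData K p} (𝔈 : PstCrystallineExtensionData 𝔇) {n : ℕ}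

/-- **(i) The datum at the base field detects exactly the `𝔇`-crystalline representations**:
`ρ|_{Γ_⊥}` is crystalline relative to `𝔅 ⊥` iff `ρ` is de Rham with unramified Weil–Deligne
representation and `N = 0` (Fontaine Exposé VIII §1.3, §2.3.7; Exposé III §5.1). [cite: FontaineAsterisque223VIII, §1.3 and §2.3.7] -/
theorem isCrystallineFn_bot_iff (ρ : FramedGaloisRep K (PadicAlgCl p) n) :
    letI := 𝔇.algebra
    IsCrystallineFn (𝔈.𝔅 ⊥ inferInstance)
        (ρ.restrictField (⊥ : IntermediateField K (AlgebraicClosure K))).matrixFn ↔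
      𝔇.IsCrystallineFramed ρ :=
  ⟨𝔈.isCrystallineFramed_of_isCrystallineFn_bot ρ,
    𝔈.isCrystallineFn_restrictField ρ ⊥ inferInstance⟩

/-- **Unramified representations are crystalline at every level**: for an unramified
`ρ : Γ_K → GL_n(ℚ̄_p)` (trivial on `I_K`) and every finite `K' ⊆ K̄`, `ρ|_{Γ_{K'}}` is crystalline relative
to `𝔅 K'` — from the datum's axiom "unramified ⇒ crystalline"
(`PstWeilDeligneData.isCrystallineFramed_of_isLocallyUnramified`, Fontaine Exposé III §5) and
`isCrystallineFn_restrictField`. [cite: FontaineAsterisque223III, §5] -/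
theorem isCrystallineFn_restrictField_of_isLocallyUnramified {ρ : FramedGaloisRep K (PadicAlgCl p) n}
    (hρ : FramedRep.IsLocallyUnramified ρ) (K' : IntermediateField K (AlgebraicClosure K))
    (hK' : FiniteDimensional K K') :
    letI := 𝔇.algebra
    IsCrystallineFn (𝔈.𝔅 K' hK') (ρ.restrictField K').matrixFn :=
  𝔈.isCrystallineFn_restrictField ρ K' hK' (𝔇.isCrystallineFramed_of_isLocallyUnramified hρ)

/-- In particular the trivial representation is crystalline at every level, for every instance `𝔈`
(non-vacuity of the axioms in the direction consumers use). [folklore] -/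
theorem isCrystallineFn_restrictField_one (K' : IntermediateField K (AlgebraicClosure K))
    (hK' : FiniteDimensional K K') :
    letI := 𝔇.algebra
    IsCrystallineFn (𝔈.𝔅 K' hK')
      ((1 : FramedGaloisRep K (PadicAlgCl p) n).restrictField K').matrixFn :=
  𝔈.isCrystallineFn_restrictField_of_isLocallyUnramified (fun _ _ => rfl) K' hK'

/-- A `𝔇`-crystalline representation is potentially crystalline relative to `𝔈.𝔅` (the standing
hypothesis `IsPotentiallyCrystallineFn` of BLGGT Lemma 1.4.3 in the tree, witnessed at `K' = ⊥`).
[cite: BarnetlambEtAl2014, §1.4 Lemma 1.4.3] -/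
theorem isPotentiallyCrystallineFn_of_isCrystallineFramed {ρ : FramedGaloisRep K (PadicAlgCl p) n}
    (hρ : 𝔇.IsCrystallineFramed ρ) :
    letI := 𝔇.algebra
    ρ.IsPotentiallyCrystallineFn 𝔈.𝔅 :=
  letI := 𝔇.algebra
  FramedGaloisRep.isPotentiallyCrystallineFn_of_bot 𝔈.𝔅 ρ
    (𝔈.isCrystallineFn_restrictField ρ ⊥ inferInstance hρ)

/-- **Ordinary-type crystalline representations are potentially diagonalizable over the summit's datum**:
for every instance `𝔈`, a `𝔇`-crystalline `ρ : Γ_K → GL_n(ℚ̄_p)` with a `Γ_K`-invariant complete flag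
(`FramedRep.HasInvariantCompleteFlag`, e.g. ordinary, or a sum of characters) is potentially
diagonalizable relative to `𝔈.𝔅` — BLGGT Lemma 1.4.3 (1), proved in the tree as
`blggt2014_lemma_1_4_3_1_holds`, applied through `isPotentiallyCrystallineFn_of_isCrystallineFramed`.
The hypothesis `hK` (`K/ℚ_p` finite for the structure `𝔇.algebra`) holds for the canonical structure on a
`p`-adic field. [cite: BarnetlambEtAl2014, §1.4 Lemma 1.4.3 (1)] -/
theorem isPotentiallyDiagonalizable_of_hasInvariantCompleteFlag
    (hK : letI := 𝔇.algebra; FiniteDimensional ℚ_[p] K) {ρ : FramedGaloisRep K (PadicAlgCl p) n}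
    (hρ : 𝔇.IsCrystallineFramed ρ) (hflag : FramedRep.HasInvariantCompleteFlag ρ) :
    letI := 𝔇.algebra
    IsPotentiallyDiagonalizable 𝔈.𝔅 ρ :=
  letI := 𝔇.algebra
  haveI := hK
  blggt2014_lemma_1_4_3_1_holds p K 𝔈.𝔅 n ρ
    (𝔈.isPotentiallyCrystallineFn_of_isCrystallineFramed hρ) hflag

/-- Restatement of `isCrystallineFn_restrictField_of_le` with the restricted function written as a
composite with `absGaloisRestrict K' K''` (definitionally the matrix function of `ρ.restrictField K''`).
[folklore] -/
theorem isCrystallineFn_comp_absGaloisRestrict_of_le (K' K'' : IntermediateField K (AlgebraicClosure K))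
    (hle : K' ≤ K'') (hK' : FiniteDimensional K K') (hK'' : FiniteDimensional K K'')
    (ρ : FramedGaloisRep K' (PadicAlgCl p) n) :
    letI := 𝔇.algebra
    IsCrystallineFn (𝔈.𝔅 K' hK') ρ.matrixFn →
      letI : Algebra K' K'' := (IntermediateField.inclusion hle).toRingHom.toAlgebra
      IsCrystallineFn (𝔈.𝔅 K'' hK'') (ρ.matrixFn ∘ absGaloisRestrict K' K'') :=
  𝔈.isCrystallineFn_restrictField_of_le K' K'' hle hK' hK'' ρ

end PstCrystallineExtensionData

/-! ### Existence for the genuine data (named fact) -/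

/-- **The genuine `p`-adic Hodge datum admits compatible crystalline extension data.**  For every finite
extension `K` of `ℚ_p` (every non-archimedean local field of characteristic zero, given as a
`ℚ_p`-algebra) there is a `p`-adic Hodge datum `𝔇 : PstWeilDeligneData K p` with the given `ℚ_p`-algebra
structure — INTENDED: Fontaine's `B_dR(K)` and `WD ∘ D_pst` — having the properties recorded by the accepted
`CrystallineDeformationRing.nonempty` (`UnramifiedWeightsZero`, `HasCrystallineDeformationRings`: Fontaine
Exposé III §5; Kisin 2008, Thm. (2.5.5), Cor. (2.7.7)), AND an instance of `PstCrystallineExtensionData 𝔇` —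
INTENDED: `K' ↦ B_cris(K')` (`F₀ = K'₀`, `φ`, filtration induced from `B_dR`), whose axioms are:
crystalline over `K` ⇒ crystalline over every finite `K'` and along `K' ≤ K''` (Fontaine Exposé III §5.1;
BLGGT §1.4 p. 13), `B_cris(K)`-admissible ⇔ de Rham with `WD` unramified and `N = 0` (Fontaine Exposé VIII
§1.3, §2.3.7; Berger 2002 Thm. 0.7), and, when `K₀ = K`, equality of the labelled Hodge–Tate weights computed
from `B_cris(K)` and from `B_dR(K)` on crystalline `ρ` (Brinon–Conrad Prop. 9.1.9).  Named fact (D-0014), a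
refinement of `CrystallineDeformationRing.nonempty` in the same shape; consumers holding `𝔇` in scope
quantify over `𝔈 : PstCrystallineExtensionData 𝔇` directly. [cite: FontaineAsterisque223III, §5.1] [cite: FontaineAsterisque223VIII, §1.3 and §2.3.7] [cite: BarnetlambEtAl2014, §1.4 (p. 13)] [cite: Kisin2007, Thm. 2.5.5 and Cor. 2.7.7] -/
def PstCrystallineExtensionData.nonempty : Prop :=
  ∀ (K : Type) [Field K] [ValuativeRel K] [TopologicalSpace K] [IsNonarchimedeanLocalField K]
    (p : ℕ) [Fact p.Prime] [CharZero K] (_ : Algebra ℚ_[p] K),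
    ∃ 𝔇 : PstWeilDeligneData K p, 𝔇.algebra = ‹Algebra ℚ_[p] K› ∧
      𝔇.UnramifiedWeightsZero ∧ 𝔇.HasCrystallineDeformationRings ∧
        Nonempty (PstCrystallineExtensionData 𝔇)

/-- `PstCrystallineExtensionData.nonempty` refines the accepted `CrystallineDeformationRing.nonempty`
(projection onto its first three clauses). [folklore] -/
theorem PstCrystallineExtensionData.nonempty.crystallineDeformationRing_nonempty
    (h : PstCrystallineExtensionData.nonempty) : CrystallineDeformationRing.nonempty := by
  intro K _ _ _ _ p _ _ alg
  obtain ⟨𝔇, halg, h0, hR, -⟩ := h K p alg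
  exact ⟨𝔇, halg, h0, hR⟩

end Pst

end Literature.NumberTheory.GaloisRepresentations

end
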